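import Summits.NavierStokesRegularity.NavierStokesRegularity.Theorems.EulerZoomLiouvillePowerGaugeEulerLiouvilleWeakBernoulliGradient
import Summits.NavierStokesRegularity.NavierStokesRegularity.Theorems.SoloSalvageWu2026WeakChain

/-!
# RENORMALISED similarity-Bernoulli transport IN THE WEAK CLASS, I: tools — the weak divergence product rule
# `div(f W) = ⟪∇f, W⟫ + 3γ f` for a Sobolev scalar `f`, and a `C¹` step family for superlevel sets
# (crux `EulerZoomLiouville.PowerGaugeEulerLiouville` = stmt-NavierStokesRegularity-19832, line `birth`, open stub `stub_selfSimilarWeakRest`)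

Width seat `ns-ezl-w1` (g7) under the crux LEAD, cell ns-regularity-ideate.  TOOL file for the genuinely weak
exactly-self-similar stratum.  The sequel `…WeakRenormalizedTransport` proves, for every `β ∈ C¹(ℝ)` with bounded
derivative, the RENORMALISED transport law `div(β(ℋ) W) = 3γ β(ℋ) − (1−2γ) β′(ℋ)|W|²` in `𝒟′(ℝ³)` for the
similarity-Bernoulli function `ℋ` of a weak class profile (`W = γy + V`), and from it the Eulerian backward-invariance
of the Bernoulli high sets `{ℋ > h}`; this file supplies the class-free ingredients:

* `WeakRenormalized.inner_gradient_eq_fderiv`, `WeakRenormalized.inner_transport_gradient_eq` — `⟪v, ∇θ x⟫ = Dθ(x) v`,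
  `⟪W x, ∇θ x⟫ = γ Dθ(x) x + Dθ(x)(V x)`;
* `WeakRenormalized.integral_mul_fderiv_apply_id` — the DILATION part: for a scalar `f` with weak derivative `g` on an
  open set `U` and a test function `θ` on `U`, `∫ f·Dθ(y)(y) = −3∫θ f − ∫ θ·g(y)(y)` (`div y = 3`; orthonormal frame,
  test functions `⟪eⱼ, y⟫θ`), with the integrability of `f·Dθ(y)(y)` and `θ·g(y)(y)`;
* **`WeakRenormalized.integral_mul_inner_transport_gradient`** — THE PRODUCT RULE WITH `div W = 3γ`: on a ball
  `B = B(0,R)`, for `f ∈ L^{3/2}(B)` with weak derivative `g ∈ L^{3/2}(B)` on `B`, `V ∈ L⁶(B)` weakly divergence free,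
  and every test function `θ` supported in `B`:
  `∫ f ⟪W, ∇θ⟫ = −∫ θ (g(W) + 3γ f)`, i.e. `div(f W) = ⟪∇f, W⟫ + 3γ f` in `𝒟′(B)`
  (the `V`-part is the tree's `Wu2026Salvage.integral_mul_fderiv_apply_eq_of_divFree`, interior mollification with
  two exponents; the `y`-part is the dilation identity);
* the smooth monotone steps `s ↦ S((n+1)(s − h))` (`S = Real.smoothTransition`; lemmas `…levelStep…`, no new definition):
  `0 ≤ · ≤ 1`, `ContDiff`, bounded nonnegative derivative, `= 0` on `s ≤ h`, and `→ 𝟙_{s > h}` as `n → ∞`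
  — the approximations of the indicator of a superlevel set through which the renormalised law passes to `{ℋ > h}`.

WHAT THIS IS NOT: not NS, not E, not the stub — weak-class TOOLS (`--supports` stmt-19832); no summit statement is
proved here. [folklore; Evans2010 §5.2.3; GilbargTrudinger2001 Lemma 7.5]
-/

noncomputable section

set_option linter.dupNamespace false

open MeasureTheory Set Filter Topology Metric Function TopologicalSpace
open scoped ENNReal NNReal RealInnerProductSpace ContDiff

namespace Summit.NavierStokesRegularity.NavierStokesRegularity.Theorems.PowerGaugeEulerLiouville

open Literature.Analysis Literature.Analysis.FunctionSpaces Literature.Analysis.FluidPDE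

namespace WeakRenormalized

/-! ## Pointwise helpers -/

/-- `⟪v, ∇θ(x)⟫ = Dθ(x) v` (Riesz representation of the Fréchet derivative). [folklore] -/
theorem inner_gradient_eq_fderiv (θ : EuclideanSpace ℝ (Fin 3) → ℝ) (x v : EuclideanSpace ℝ (Fin 3)) :
    ⟪v, gradient θ x⟫ = fderiv ℝ θ x v := by
  rw [real_inner_comm, gradient, InnerProductSpace.toDual_symm_apply]

/-- `⟪W x, ∇θ x⟫ = γ Dθ(x) x + Dθ(x)(V x)` for `W = γy + V` (centre `0`). [folklore] -/
theorem inner_transport_gradient_eq (γ : ℝ) (V : EuclideanSpace ℝ (Fin 3) → EuclideanSpace ℝ (Fin 3))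
    (θ : EuclideanSpace ℝ (Fin 3) → ℝ) (x : EuclideanSpace ℝ (Fin 3)) :
    ⟪selfSimilarTransport γ 0 V x, gradient θ x⟫ = γ * fderiv ℝ θ x x + fderiv ℝ θ x (V x) := by
  rw [inner_gradient_eq_fderiv, selfSimilarTransport_apply, sub_zero, map_add, map_smul, smul_eq_mul]

/-! ## The dilation identity `∫ f·Dθ(y)(y) = −3∫θf − ∫θ·g(y)(y)` -/

section Dilation

variable {f : EuclideanSpace ℝ (Fin 3) → ℝ} {g : EuclideanSpace ℝ (Fin 3) → EuclideanSpace ℝ (Fin 3) →L[ℝ] ℝ}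

/-- `D(⟪c, ·⟫ θ)(x) v = ⟪c, v⟫ θ(x) + ⟪c, x⟫ Dθ(x) v`. [folklore] -/
theorem fderiv_innerConst_mul_apply {θ : EuclideanSpace ℝ (Fin 3) → ℝ} (hθd : Differentiable ℝ θ)
    (c x v : EuclideanSpace ℝ (Fin 3)) :
    fderiv ℝ (fun y => ⟪c, y⟫ * θ y) x v = ⟪c, v⟫ * θ x + ⟪c, x⟫ * fderiv ℝ θ x v := by
  have h1 : HasFDerivAt (fun y : EuclideanSpace ℝ (Fin 3) => ⟪c, y⟫) (innerSL ℝ c) x := (innerSL ℝ c).hasFDerivAt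
  have h2 : HasFDerivAt θ (fderiv ℝ θ x) x := (hθd x).hasFDerivAt
  have h : HasFDerivAt (fun y => ⟪c, y⟫ * θ y) (⟪c, x⟫ • fderiv ℝ θ x + θ x • innerSL ℝ c) x := h1.mul h2
  rw [h.fderiv, _root_.add_apply, _root_.smul_apply, _root_.smul_apply, innerSL_apply_apply, smul_eq_mul,
    smul_eq_mul]
  ring

/-- The data of the dilation identity along the standard frame: with `φⱼ = ⟪eⱼ, ·⟫ θ`,
(a) `∫ ∂ⱼφⱼ f = −∫ φⱼ g(eⱼ)`, (b) both integrands are integrable, (c) the pointwise expansions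
`f Dθ(x) x = Σⱼ (∂ⱼφⱼ f − θ f)` and `θ g(x) x = Σⱼ φⱼ g(eⱼ)`. [folklore] -/
theorem dilation_frame_data {U : Opens (EuclideanSpace ℝ (Fin 3))} (hf : HasWeakFDerivOn U volume f g)
    {θ : EuclideanSpace ℝ (Fin 3) → ℝ} (hθ : IsTestFunctionOn U θ) :
    (∀ j, ∫ x, fderiv ℝ (fun y => ⟪stdOrthonormalBasis ℝ (EuclideanSpace ℝ (Fin 3)) j, y⟫ * θ y) x
          (stdOrthonormalBasis ℝ (EuclideanSpace ℝ (Fin 3)) j) * f x =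
        -∫ x, (⟪stdOrthonormalBasis ℝ (EuclideanSpace ℝ (Fin 3)) j, x⟫ * θ x) *
          g x (stdOrthonormalBasis ℝ (EuclideanSpace ℝ (Fin 3)) j)) ∧
    (∀ j, Integrable (fun x => fderiv ℝ (fun y => ⟪stdOrthonormalBasis ℝ (EuclideanSpace ℝ (Fin 3)) j, y⟫ * θ y) x
          (stdOrthonormalBasis ℝ (EuclideanSpace ℝ (Fin 3)) j) * f x) volume) ∧
    (∀ j, Integrable (fun x => (⟪stdOrthonormalBasis ℝ (EuclideanSpace ℝ (Fin 3)) j, x⟫ * θ x) *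
          g x (stdOrthonormalBasis ℝ (EuclideanSpace ℝ (Fin 3)) j)) volume) ∧
    (∀ x, f x * fderiv ℝ θ x x =
        ∑ j, (fderiv ℝ (fun y => ⟪stdOrthonormalBasis ℝ (EuclideanSpace ℝ (Fin 3)) j, y⟫ * θ y) x
          (stdOrthonormalBasis ℝ (EuclideanSpace ℝ (Fin 3)) j) * f x - θ x * f x)) ∧
    (∀ x, θ x * g x x = ∑ j, (⟪stdOrthonormalBasis ℝ (EuclideanSpace ℝ (Fin 3)) j, x⟫ * θ x) *
        g x (stdOrthonormalBasis ℝ (EuclideanSpace ℝ (Fin 3)) j)) := by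
  have hθd : Differentiable ℝ θ := hθ.contDiff.differentiable (by simp)
  set e := stdOrthonormalBasis ℝ (EuclideanSpace ℝ (Fin 3)) with hedef
  have hWt : ∀ j, IsTestFunctionOn U (fun y => ⟪e j, y⟫ * θ y) := fun j =>
    SobolevApprox.isTestFunctionOn_mul_left hθ (contDiff_const.inner ℝ contDiff_id)
  have hWderiv : ∀ j x, fderiv ℝ (fun y => ⟪e j, y⟫ * θ y) x (e j) = θ x + ⟪e j, x⟫ * fderiv ℝ θ x (e j) := by
    intro j x
    rw [fderiv_innerConst_mul_apply hθd]
    have h1 : ⟪e j, e j⟫ = (1 : ℝ) := by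
      rw [real_inner_self_eq_norm_sq, e.orthonormal.1 j, one_pow]
    rw [h1, one_mul]
  have hsumx : ∀ x : EuclideanSpace ℝ (Fin 3), ∑ j, ⟪e j, x⟫ • e j = x := fun x => e.sum_repr' x
  have hfl : LocallyIntegrableOn f (U : Set (EuclideanSpace ℝ (Fin 3))) volume := hf.locallyIntegrableOn
  -- (b) integrability
  have hI1 : ∀ j, Integrable (fun x => fderiv ℝ (fun y => ⟪e j, y⟫ * θ y) x (e j) * f x) volume := by
    intro j
    have h := SobolevApprox.integrableOn_fderiv_testFunction_smul (hWt j) (e j) hfl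
    simp only [smul_eq_mul] at h
    exact h.integrable_of_forall_notMem_eq_zero fun x hx => by
      rw [fderiv_of_notMem_tsupport ℝ (fun h' => hx ((hWt j).tsupport_subset h')),
        _root_.zero_apply, zero_mul]
  have hI2 : ∀ j, Integrable (fun x => (⟪e j, x⟫ * θ x) * g x (e j)) volume := by
    intro j
    have h := SobolevApprox.integrableOn_testFunction_smul (hWt j) (SobolevApprox.locallyIntegrableOn_deriv_apply hf (e j))
    simp only [smul_eq_mul] at h
    exact h.integrable_of_forall_notMem_eq_zero fun x hx => by
      rw [image_eq_zero_of_notMem_tsupport (fun h' => hx ((hWt j).tsupport_subset h')), zero_mul]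
  -- (a) the defining identities, as whole-space integrals
  have hj : ∀ j, ∫ x, fderiv ℝ (fun y => ⟪e j, y⟫ * θ y) x (e j) * f x = -∫ x, (⟪e j, x⟫ * θ x) * g x (e j) := by
    intro j
    have h := hf.integral_fderiv_smul_eq _ (e j) (hWt j)
    simp only [smul_eq_mul] at h
    have hK1 : ∀ x, x ∉ (U : Set (EuclideanSpace ℝ (Fin 3))) → fderiv ℝ (fun y => ⟪e j, y⟫ * θ y) x (e j) * f x = 0 :=
      fun x hx => by
        rw [fderiv_of_notMem_tsupport ℝ (fun h' => hx ((hWt j).tsupport_subset h')),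
          _root_.zero_apply, zero_mul]
    have hK2 : ∀ x, x ∉ (U : Set (EuclideanSpace ℝ (Fin 3))) → (⟪e j, x⟫ * θ x) * g x (e j) = 0 :=
      fun x hx => by rw [image_eq_zero_of_notMem_tsupport (fun h' => hx ((hWt j).tsupport_subset h')), zero_mul]
    rwa [setIntegral_eq_integral_of_forall_compl_eq_zero hK1, setIntegral_eq_integral_of_forall_compl_eq_zero hK2] at h
  -- (c) pointwise expansions
  have hleft : ∀ x, f x * fderiv ℝ θ x x = ∑ j, (fderiv ℝ (fun y => ⟪e j, y⟫ * θ y) x (e j) * f x - θ x * f x) := by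
    intro x
    have h1 : ∑ j, ⟪e j, x⟫ * fderiv ℝ θ x (e j) = fderiv ℝ θ x x :=
      calc ∑ j, ⟪e j, x⟫ * fderiv ℝ θ x (e j) = ∑ j, fderiv ℝ θ x (⟪e j, x⟫ • e j) :=
            Finset.sum_congr rfl fun j _ => by rw [map_smul, smul_eq_mul]
        _ = fderiv ℝ θ x (∑ j, ⟪e j, x⟫ • e j) := (map_sum _ _ _).symm
        _ = fderiv ℝ θ x x := by rw [hsumx]
    rw [← h1, Finset.mul_sum]
    exact Finset.sum_congr rfl fun j _ => by rw [hWderiv]; ring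
  have hright : ∀ x, θ x * g x x = ∑ j, (⟪e j, x⟫ * θ x) * g x (e j) := by
    intro x
    symm
    calc ∑ j, (⟪e j, x⟫ * θ x) * g x (e j) = θ x * ∑ j, g x (⟪e j, x⟫ • e j) := by
          rw [Finset.mul_sum]
          exact Finset.sum_congr rfl fun j _ => by rw [map_smul, smul_eq_mul]; ring
      _ = θ x * g x (∑ j, ⟪e j, x⟫ • e j) := by rw [map_sum]
      _ = θ x * g x x := by rw [hsumx]
  exact ⟨hj, hI1, hI2, hleft, hright⟩

/-- `θ·g(y)(y)` is integrable for a test function `θ` on `U` and a weak derivative `g` on `U`. [folklore] -/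
theorem integrable_testFunction_mul_apply_id {U : Opens (EuclideanSpace ℝ (Fin 3))} (hf : HasWeakFDerivOn U volume f g)
    {θ : EuclideanSpace ℝ (Fin 3) → ℝ} (hθ : IsTestFunctionOn U θ) :
    Integrable (fun x => θ x * g x x) volume := by
  obtain ⟨-, -, hI2, -, hright⟩ := dilation_frame_data hf hθ
  rw [show (fun x => θ x * g x x) = fun x => ∑ j, (⟪stdOrthonormalBasis ℝ (EuclideanSpace ℝ (Fin 3)) j, x⟫ * θ x) *
      g x (stdOrthonormalBasis ℝ (EuclideanSpace ℝ (Fin 3)) j) from funext hright]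
  exact integrable_finsetSum _ fun j _ => hI2 j

/-- `f·Dθ(y)(y)` is integrable for a test function `θ` on `U` and `f` weakly differentiable on `U`. [folklore] -/
theorem integrable_mul_fderiv_apply_id {U : Opens (EuclideanSpace ℝ (Fin 3))} (hf : HasWeakFDerivOn U volume f g)
    {θ : EuclideanSpace ℝ (Fin 3) → ℝ} (hθ : IsTestFunctionOn U θ) :
    Integrable (fun x => f x * fderiv ℝ θ x x) volume := by
  obtain ⟨-, hI1, -, hleft, -⟩ := dilation_frame_data hf hθ
  have hIθf : Integrable (fun x => θ x * f x) volume := by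
    have h := SobolevApprox.integrableOn_testFunction_smul hθ hf.locallyIntegrableOn
    simp only [smul_eq_mul] at h
    exact h.integrable_of_forall_notMem_eq_zero fun x hx => by
      rw [image_eq_zero_of_notMem_tsupport (fun h' => hx (hθ.tsupport_subset h')), zero_mul]
  rw [show (fun x => f x * fderiv ℝ θ x x) = _ from funext hleft]
  exact integrable_finsetSum _ fun j _ => (hI1 j).sub hIθf

/-- **The dilation identity.**  Let `f` have the weak derivative `g` on the open set `U` and let `θ` be a test function
on `U`.  Then `∫ f(y) Dθ(y)(y) dy = −3 ∫ θ f − ∫ θ(y) g(y)(y) dy` (`div y = 3` on `ℝ³`): the defining identity of the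
weak derivative tested with `⟪eⱼ, y⟫ θ`, `∂ⱼ(⟪eⱼ,y⟫θ) = θ + ⟪eⱼ,y⟫∂ⱼθ`, summed over an orthonormal frame. [folklore] -/
theorem integral_mul_fderiv_apply_id {U : Opens (EuclideanSpace ℝ (Fin 3))} (hf : HasWeakFDerivOn U volume f g)
    {θ : EuclideanSpace ℝ (Fin 3) → ℝ} (hθ : IsTestFunctionOn U θ) :
    ∫ x, f x * fderiv ℝ θ x x = -3 * (∫ x, θ x * f x) - ∫ x, θ x * g x x := by
  obtain ⟨hj, hI1, hI2, hleft, hright⟩ := dilation_frame_data hf hθ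
  have hIθf : Integrable (fun x => θ x * f x) volume := by
    have h := SobolevApprox.integrableOn_testFunction_smul hθ hf.locallyIntegrableOn
    simp only [smul_eq_mul] at h
    exact h.integrable_of_forall_notMem_eq_zero fun x hx => by
      rw [image_eq_zero_of_notMem_tsupport (fun h' => hx (hθ.tsupport_subset h')), zero_mul]
  have h3 : (Finset.univ : Finset (Fin (Module.finrank ℝ (EuclideanSpace ℝ (Fin 3))))).card = 3 := by
    rw [Finset.card_univ, Fintype.card_fin, finrank_euclideanSpace_fin]
  set e := stdOrthonormalBasis ℝ (EuclideanSpace ℝ (Fin 3)) with hedef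
  have hIsub : ∀ j, Integrable (fun x => fderiv ℝ (fun y => ⟪e j, y⟫ * θ y) x (e j) * f x - θ x * f x) volume :=
    fun j => (hI1 j).sub hIθf
  have hsub : ∀ j, ∫ x, (fderiv ℝ (fun y => ⟪e j, y⟫ * θ y) x (e j) * f x - θ x * f x) =
      -(∫ x, (⟪e j, x⟫ * θ x) * g x (e j)) - ∫ x, θ x * f x := fun j => by
    rw [integral_sub (hI1 j) hIθf, hj j]
  rw [integral_congr_ae (Eventually.of_forall hleft), integral_finsetSum _ fun j _ => hIsub j,
    integral_congr_ae (Eventually.of_forall hright), integral_finsetSum _ fun j _ => hI2 j,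
    Finset.sum_congr rfl fun j _ => hsub j, Finset.sum_sub_distrib, Finset.sum_const, h3, Finset.sum_neg_distrib,
    nsmul_eq_mul]
  push_cast
  ring

end Dilation

/-! ## The product rule with `div W = 3γ` -/

section Product

variable {V : EuclideanSpace ℝ (Fin 3) → EuclideanSpace ℝ (Fin 3)}
  {f : EuclideanSpace ℝ (Fin 3) → ℝ} {g : EuclideanSpace ℝ (Fin 3) → EuclideanSpace ℝ (Fin 3) →L[ℝ] ℝ}

/-- `1 ≤ 3/2` and `3/2 ≠ ∞` in `ℝ≥0∞`. [folklore] -/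
theorem threeHalves_exponent : (1 : ℝ≥0∞) ≤ 3 / 2 ∧ (3 : ℝ≥0∞) / 2 ≠ ⊤ := by
  refine ⟨?_, ENNReal.div_ne_top (by norm_num) (by norm_num)⟩
  rw [ENNReal.le_div_iff_mul_le (by norm_num) (by norm_num)]; norm_num

/-- **THE WEAK DIVERGENCE PRODUCT RULE `div(f W) = ⟪∇f, W⟫ + 3γ f`.**  On the ball `B = B(0,R)` let `f ∈ L^{3/2}(B)` have
the weak derivative `g ∈ L^{3/2}(B)`, let `V ∈ L⁶(B)` be weakly divergence free (on `ℝ³`), and let `θ` be a test function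
supported in `B`.  Then for `W = γy + V` (`selfSimilarTransport γ 0 V`):
`∫ f ⟪W, ∇θ⟫ = −∫ θ (g(W) + 3γ f)`.
The `V`-part `∫ f Dθ(V) = −∫ θ g(V)` is the tree's interior-mollification lemma
`Wu2026Salvage.integral_mul_fderiv_apply_eq_of_divFree` (exponents `3/2, 3`); the `y`-part is `integral_mul_fderiv_apply_id`.
[folklore; Evans2010 §5.2.3 Thm. 1] -/
theorem integral_mul_inner_transport_gradient {γ R : ℝ} (hf : HasWeakFDerivOn (⟨ball (0 : EuclideanSpace ℝ (Fin 3)) R, isOpen_ball⟩ : Opens (EuclideanSpace ℝ (Fin 3))) volume f g)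
    (hf32 : MemLp f (3 / 2 : ℝ≥0∞) (volume.restrict (ball (0 : EuclideanSpace ℝ (Fin 3)) R)))
    (hg32 : MemLp g (3 / 2 : ℝ≥0∞) (volume.restrict (ball (0 : EuclideanSpace ℝ (Fin 3)) R)))
    (hV6 : MemLp V 6 (volume.restrict (ball (0 : EuclideanSpace ℝ (Fin 3)) R)))
    (hdiv : IsWeaklyDivFree V)
    {θ : EuclideanSpace ℝ (Fin 3) → ℝ} (hθ : IsTestFunctionOn (⟨ball (0 : EuclideanSpace ℝ (Fin 3)) R, isOpen_ball⟩ : Opens (EuclideanSpace ℝ (Fin 3))) θ) :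
    ∫ x, f x * ⟪selfSimilarTransport γ 0 V x, gradient θ x⟫ =
      -∫ x, θ x * (g x (selfSimilarTransport γ 0 V x) + 3 * γ * f x) := by
  haveI : IsFiniteMeasure ((volume : Measure (EuclideanSpace ℝ (Fin 3))).restrict (ball 0 R)) :=
    isFiniteMeasure_restrict.2 measure_ball_lt_top.ne
  haveI := Wu2026Salvage.holderTriple_threeHalves_three'
  have hθc : Continuous θ := hθ.contDiff.continuous
  have hDθc : Continuous (fderiv ℝ θ) := hθ.contDiff.continuous_fderiv (by simp)
  have hθK : ∀ x, x ∉ (ball (0 : EuclideanSpace ℝ (Fin 3)) R) → θ x = 0 := fun x hx =>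
    image_eq_zero_of_notMem_tsupport fun h' => hx (hθ.tsupport_subset h')
  have hDθK : ∀ x, x ∉ (ball (0 : EuclideanSpace ℝ (Fin 3)) R) → fderiv ℝ θ x = 0 := fun x hx =>
    fderiv_of_notMem_tsupport ℝ fun h' => hx (hθ.tsupport_subset h')
  obtain ⟨C₀, hC₀⟩ := hθc.bounded_above_of_compact_support hθ.hasCompactSupport
  obtain ⟨C₁, hC₁⟩ := hDθc.bounded_above_of_compact_support (hθ.hasCompactSupport.fderiv (𝕜 := ℝ))
  have hV3 : MemLp V 3 (volume.restrict (ball (0 : EuclideanSpace ℝ (Fin 3)) R)) := hV6.mono_exponent (by norm_num)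
  -- ### the `V`-part (interior mollification, tree)
  have hdiv' : ∀ ψ : EuclideanSpace ℝ (Fin 3) → ℝ, ContDiff ℝ ∞ ψ → HasCompactSupport ψ →
      tsupport ψ ⊆ ((⟨ball (0 : EuclideanSpace ℝ (Fin 3)) R, isOpen_ball⟩ : Opens (EuclideanSpace ℝ (Fin 3))) : Set (EuclideanSpace ℝ (Fin 3))) →
      ∫ x, fderiv ℝ ψ x (V x) = 0 := by
    intro ψ hψ hψc _
    have h := hdiv ψ ⟨hψ, hψc, fun _ _ => trivial⟩
    simp_rw [inner_gradient_eq_fderiv] at h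
    exact h
  have hB : ∫ x, f x * fderiv ℝ θ x (V x) = -∫ x, θ x * g x (V x) :=
    Wu2026Salvage.integral_mul_fderiv_apply_eq_of_divFree (p := (3 : ℝ≥0∞) / 2) (p' := 3) (q := (3 : ℝ≥0∞) / 2)
      (q' := 3) threeHalves_exponent.1 threeHalves_exponent.2 threeHalves_exponent.1 threeHalves_exponent.2 hf hf32
      hg32 hV3 hV3 hdiv' hθ.contDiff
      hθ.hasCompactSupport hθ.tsupport_subset
  -- ### the `y`-part (dilation identity)
  have hA := integral_mul_fderiv_apply_id hf hθ
  -- ### integrability of the five pairings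
  have hIθf : Integrable (fun x => θ x * f x) volume := by
    have h := SobolevApprox.integrableOn_testFunction_smul hθ hf.locallyIntegrableOn
    simp only [smul_eq_mul] at h
    exact h.integrable_of_forall_notMem_eq_zero fun x hx => by rw [hθK x hx, zero_mul]
  have hIa : Integrable (fun x => f x * fderiv ℝ θ x x) volume := integrable_mul_fderiv_apply_id hf hθ
  have hIgx : Integrable (fun x => θ x * g x x) volume := integrable_testFunction_mul_apply_id hf hθ
  have hIb : Integrable (fun x => f x * fderiv ℝ θ x (V x)) volume := by
    have h : IntegrableOn (fun x => f x * fderiv ℝ θ x (V x)) (ball (0 : EuclideanSpace ℝ (Fin 3)) R) volume := by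
      refine Wu2026Salvage.integrable_of_norm_le_mul (p := (3 : ℝ≥0∞) / 2) (q := 3) (C := C₁)
        (hf32.1.mul (Wu2026Salvage.aestronglyMeasurable_clm_apply hDθc.aestronglyMeasurable hV3.1)) hf32 hV3
        fun x => ?_
      rw [norm_mul, mul_left_comm]
      exact mul_le_mul_of_nonneg_left (((fderiv ℝ θ x).le_opNorm _).trans
        (mul_le_mul_of_nonneg_right (hC₁ x) (norm_nonneg _))) (norm_nonneg _)
    exact h.integrable_of_forall_notMem_eq_zero fun x hx => by rw [hDθK x hx, _root_.zero_apply, mul_zero]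
  have hIgV : Integrable (fun x => θ x * g x (V x)) volume := by
    have h : IntegrableOn (fun x => θ x * g x (V x)) (ball (0 : EuclideanSpace ℝ (Fin 3)) R) volume := by
      refine Wu2026Salvage.integrable_of_norm_le_mul (p := (3 : ℝ≥0∞) / 2) (q := 3) (C := C₀)
        (hθc.aestronglyMeasurable.mul (Wu2026Salvage.aestronglyMeasurable_clm_apply hg32.1 hV3.1)) hg32 hV3
        fun x => ?_
      rw [norm_mul]
      exact mul_le_mul (hC₀ x) ((g x).le_opNorm _) (norm_nonneg _) ((norm_nonneg _).trans (hC₀ x))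
    exact h.integrable_of_forall_notMem_eq_zero fun x hx => by rw [hθK x hx, zero_mul]
  -- ### assemble
  have hlhs : (fun x => f x * ⟪selfSimilarTransport γ 0 V x, gradient θ x⟫) =
      fun x => γ * (f x * fderiv ℝ θ x x) + f x * fderiv ℝ θ x (V x) := by
    funext x; rw [inner_transport_gradient_eq]; ring
  have hrhs : (fun x => θ x * (g x (selfSimilarTransport γ 0 V x) + 3 * γ * f x)) =
      fun x => γ * (θ x * g x x) + θ x * g x (V x) + 3 * γ * (θ x * f x) := by
    funext x
    rw [selfSimilarTransport_apply, sub_zero, map_add, map_smul, smul_eq_mul]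
    ring
  have hI12 : Integrable (fun x => γ * (θ x * g x x) + θ x * g x (V x)) volume := (hIgx.const_mul γ).add hIgV
  have e1 : ∫ x, (γ * (f x * fderiv ℝ θ x x) + f x * fderiv ℝ θ x (V x)) =
      γ * (∫ x, f x * fderiv ℝ θ x x) + ∫ x, f x * fderiv ℝ θ x (V x) := by
    rw [integral_add (hIa.const_mul γ) hIb, integral_const_mul]
  have e2 : ∫ x, (γ * (θ x * g x x) + θ x * g x (V x) + 3 * γ * (θ x * f x)) =
      γ * (∫ x, θ x * g x x) + (∫ x, θ x * g x (V x)) + 3 * γ * ∫ x, θ x * f x := by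
    rw [integral_add hI12 (hIθf.const_mul _), integral_add (hIgx.const_mul γ) hIgV, integral_const_mul,
      integral_const_mul]
  rw [hlhs, hrhs, e1, e2, hA, hB]
  ring

end Product

/-! ## The smooth step family for superlevel sets -/

section Steps

/-! The smooth monotone steps `s ↦ S((n+1)(s − h))`, `S = Real.smoothTransition` (written out, no new definition):
they vanish for `s ≤ h`, equal `1` for `s ≥ h + 1/(n+1)`, and increase to the indicator of `{s > h}` as `n → ∞`. -/

/-- The step `s ↦ S((n+1)(s−h))` is smooth. [folklore] -/
theorem contDiff_levelStep (n : ℕ) (h : ℝ) {m : ℕ∞} : ContDiff ℝ m (fun s : ℝ => Real.smoothTransition (((n : ℝ) + 1) * (s - h))) :=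
  Real.smoothTransition.contDiff.comp ((contDiff_const.mul (contDiff_id.sub contDiff_const)))

/-- The step `s ↦ S((n+1)(s−h))` is continuous. [folklore] -/
theorem continuous_levelStep (n : ℕ) (h : ℝ) : Continuous (fun s : ℝ => Real.smoothTransition (((n : ℝ) + 1) * (s - h))) :=
  Real.smoothTransition.continuous.comp (continuous_const.mul (continuous_id.sub continuous_const))

/-- The step `S((n+1)(s−h))` is nonnegative. [folklore] -/
theorem levelStep_nonneg (n : ℕ) (h s : ℝ) : 0 ≤ Real.smoothTransition (((n : ℝ) + 1) * (s - h)) :=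
  Real.smoothTransition.nonneg _

/-- The step `S((n+1)(s−h))` is at most `1`. [folklore] -/
theorem levelStep_le_one (n : ℕ) (h s : ℝ) : Real.smoothTransition (((n : ℝ) + 1) * (s - h)) ≤ 1 :=
  Real.smoothTransition.le_one _

/-- The step `S((n+1)(s−h))` vanishes for `s ≤ h`. [folklore] -/
theorem levelStep_of_le {n : ℕ} {h s : ℝ} (hs : s ≤ h) : Real.smoothTransition (((n : ℝ) + 1) * (s - h)) = 0 :=
  Real.smoothTransition.zero_of_nonpos (mul_nonpos_of_nonneg_of_nonpos (by positivity) (sub_nonpos.2 hs))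

/-- The step `s ↦ S((n+1)(s−h))` is monotone. [folklore] -/
theorem monotone_levelStep (n : ℕ) (h : ℝ) : Monotone (fun s : ℝ => Real.smoothTransition (((n : ℝ) + 1) * (s - h))) := fun a b hab =>
  Real.smoothTransition.monotone (mul_le_mul_of_nonneg_left (sub_le_sub_right hab h) (by positivity))

/-- The step `s ↦ S((n+1)(s−h))` has nonnegative derivative. [folklore] -/
theorem deriv_levelStep_nonneg (n : ℕ) (h s : ℝ) : 0 ≤ deriv (fun s : ℝ => Real.smoothTransition (((n : ℝ) + 1) * (s - h))) s :=
  (monotone_levelStep n h).deriv_nonneg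

/-- The derivative of `Real.smoothTransition` is bounded. [folklore] -/
theorem exists_bound_deriv_smoothTransition : ∃ M : ℝ, ∀ z : ℝ, ‖deriv Real.smoothTransition z‖ ≤ M := by
  have hc : Continuous (deriv Real.smoothTransition) :=
    (Real.smoothTransition.contDiff (n := 1)).continuous_deriv le_rfl
  obtain ⟨M, hM⟩ := isCompact_Icc.exists_bound_of_continuousOn (s := Icc (0 : ℝ) 1) hc.continuousOn
  refine ⟨max M 0, fun z => ?_⟩
  by_cases hz : z ∈ Icc (0 : ℝ) 1
  · exact (hM z hz).trans (le_max_left _ _)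
  · rw [mem_Icc, not_and_or, not_le, not_le] at hz
    have h0 : deriv Real.smoothTransition z = 0 := by
      rcases hz with hz | hz
      · have he : Real.smoothTransition =ᶠ[𝓝 z] fun _ => (0 : ℝ) :=
          (eventually_lt_nhds hz).mono fun y hy => Real.smoothTransition.zero_of_nonpos hy.le
        rw [he.deriv_eq, deriv_const]
      · have he : Real.smoothTransition =ᶠ[𝓝 z] fun _ => (1 : ℝ) :=
          (eventually_gt_nhds hz).mono fun y hy => Real.smoothTransition.one_of_one_le hy.le
        rw [he.deriv_eq, deriv_const]
    rw [h0, norm_zero]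
    exact le_max_right _ _

/-- The derivative of the step `s ↦ S((n+1)(s−h))` is bounded (by `(n+1) sup|S′|`). [folklore] -/
theorem exists_bound_deriv_levelStep (n : ℕ) (h : ℝ) :
    ∃ L : ℝ, ∀ z : ℝ, ‖deriv (fun s : ℝ => Real.smoothTransition (((n : ℝ) + 1) * (s - h))) z‖ ≤ L := by
  obtain ⟨M, hM⟩ := exists_bound_deriv_smoothTransition
  refine ⟨((n : ℝ) + 1) * M, fun z => ?_⟩
  have hd : HasDerivAt (fun s : ℝ => Real.smoothTransition (((n : ℝ) + 1) * (s - h)))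
      (deriv Real.smoothTransition (((n : ℝ) + 1) * (z - h)) * (((n : ℝ) + 1) * 1)) z := by
    have h1 : HasDerivAt (fun s : ℝ => ((n : ℝ) + 1) * (s - h)) (((n : ℝ) + 1) * 1) z :=
      ((hasDerivAt_id z).sub_const h).const_mul _
    exact ((Real.smoothTransition.contDiff (n := 1)).differentiable (by simp) _).hasDerivAt.comp z h1
  rw [hd.deriv, mul_one, norm_mul, mul_comm]
  exact mul_le_mul (le_of_eq (by rw [Real.norm_eq_abs, abs_of_nonneg (by positivity)])) (hM _)
    (norm_nonneg _) (by positivity)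

/-- `S((n+1)(s−h)) → 𝟙_{s > h}` as `n → ∞` (it is eventually `1` when `s > h`, identically `0` when `s ≤ h`). [folklore] -/
theorem tendsto_levelStep (h s : ℝ) :
    Tendsto (fun n : ℕ => Real.smoothTransition (((n : ℝ) + 1) * (s - h))) atTop (𝓝 (if h < s then 1 else 0)) := by
  split_ifs with hs
  · have hev : ∀ᶠ n : ℕ in atTop, Real.smoothTransition (((n : ℝ) + 1) * (s - h)) = 1 := by
      obtain ⟨N, hN⟩ := exists_nat_ge (1 / (s - h))
      refine (eventually_ge_atTop N).mono fun n hn => Real.smoothTransition.one_of_one_le ?_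
      have hsh : 0 < s - h := sub_pos.2 hs
      have h1 : 1 / (s - h) ≤ (n : ℝ) + 1 := hN.trans ((Nat.cast_le.2 hn).trans (le_add_of_nonneg_right zero_le_one))
      calc (1 : ℝ) = 1 / (s - h) * (s - h) := by field_simp
        _ ≤ ((n : ℝ) + 1) * (s - h) := mul_le_mul_of_nonneg_right h1 hsh.le
    exact tendsto_const_nhds.congr' (hev.mono fun n hn => hn.symm)
  · simp_rw [levelStep_of_le (not_lt.1 hs)]
    exact tendsto_const_nhds

end Steps

end WeakRenormalized

end Summit.NavierStokesRegularity.NavierStokesRegularity.Theorems.PowerGaugeEulerLiouville
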